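import Mathlib
import HarnessLib
import Literature.Probability.Percolation.Percolation
import Literature.Probability.Percolation.Crossings

/-!
# Sketch — first lemmas of the crux ideas (ideator 3, round 1) for
`BoundaryDefectGaussianR` (stmt-CriticalPhenomena-14132), route CardyBoundaryCoulombGas.

The crux itself is informal (needs `CollarLegModel`); the first lemmas below are its typeable
percolation-side shadows in the two rectilinear geometries where exact integrable structure
lives: the free END of a half-strip (card `corner-kac-tower-strip-end`) and a WALL of a strip
(card `edge-spin-dictionary`).  All constants were located with `lean search --decl`:
`Literature.Probability.Percolation.bondPercolation`, `.half`, `.openConnIn`,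
`Literature.Probability.LatticeModels.zdGraph`, `.Site`.
-/

namespace Summit.CriticalPhenomena.CardyFormulaZ2.Cruxes.BoundaryDefectGaussianR.IdeatorThree

open Filter
open Literature.Probability.Percolation Literature.Probability.LatticeModels

/-- The lattice half-strip `{0 ≤ v₀ ≤ n, v₁ ≤ 0}` of width `n` (vertex columns `0..n`), whose
free END is the segment `{v₁ = 0}` with the two convex `π/2` corners `(0,0)` and `(n,0)`. -/
def halfStrip (n : ℕ) : Set (Site 2) := {v | 0 ≤ v 0 ∧ v 0 ≤ (n : ℤ) ∧ v 1 ≤ 0}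

/-- The lattice strip `ℤ × [0,n]` of width `n`; its lower WALL is `{v₁ = 0}`. -/
def strip (n : ℕ) : Set (Site 2) := {v | 0 ≤ v 1 ∧ v 1 ≤ (n : ℤ)}

/-- `P_{1/2}` of an event of bond percolation on `ℤ²`. -/
noncomputable def Phalf (A : Set (BondConfig (Site 2))) : ℝ :=
  (bondPercolation (zdGraph 2) half).real A

/-- **Card A, first lemma (literal instance of the crux: the (2;2) member at the end of the
half-strip, `w = -cos(π z)` maps the half-strip onto `ℍ`).**  END PROFILE LAW: for
`0 < u < u' < 1`, `n^{2/3} · P_{1/2}[(⌊un⌋,0) ↔ (⌊u'n⌋,0) inside the half-strip of width n]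
→ C · |cos πu − cos πu'|^{-2/3} · (sin πu · sin πu')^{1/3}` with one constant `C > 0`
(pair exponent `2h_{1,3} = 2/3`, one-point factors `|w'|^{h_{1,3}}`, `h_{1,3} = 1/3`). -/
def EndProfileLaw : Prop :=
  ∃ C : ℝ, 0 < C ∧ ∀ u u' : ℝ, 0 < u → u < u' → u' < 1 →
    Tendsto (fun n : ℕ ↦ (n : ℝ) ^ (2 / 3 : ℝ) *
        Phalf (openConnIn (halfStrip n) ![⌊u * n⌋, 0] ![⌊u' * n⌋, 0]))
      atTop
      (nhds (C * |Real.cos (Real.pi * u) - Real.cos (Real.pi * u')| ^ (-(2 / 3) : ℝ) *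
        (Real.sin (Real.pi * u) * Real.sin (Real.pi * u')) ^ (1 / 3 : ℝ)))

/-- **Card A, corner member `m = 1` of the tower (angle doubling at both `π/2` corners:
`2·2·h_{1,3} = 4/3`; MNdGB maximal 1-nest exponent `(2/3)·1·2`).**  Exponent form. -/
def CornerToCornerFourThirds : Prop :=
  Tendsto (fun n : ℕ ↦ Real.log (Phalf (openConnIn (halfStrip n) ![0, 0] ![(n : ℤ), 0])) /
      Real.log (n : ℝ)) atTop (nhds (-(4 / 3 : ℝ)))

/-- Sharp form of the corner member (a scaling constant exists). -/
def CornerToCornerSharp : Prop :=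
  ∃ C : ℝ, 0 < C ∧ Tendsto (fun n : ℕ ↦ (n : ℝ) ^ (4 / 3 : ℝ) *
      Phalf (openConnIn (halfStrip n) ![0, 0] ![(n : ℤ), 0])) atTop (nhds C)

/-- **Card B, first lemma (literal instance of the crux: the (2;2) member along a wall of the
strip, `w = exp(π z / n)`).**  WALL TWO-POINT LAW: for `t > 0`,
`n^{2/3} · P_{1/2}[(0,0) ↔ (⌊tn⌋,0) inside ℤ×[0,n]] → C · e^{-π t/3} · (1 − e^{-π t})^{-2/3}`;
spectrally: gaps `π(1/3 + j)/n` AND amplitude ratios `(2/3)_j / j!` of the `h_{1,3}` tower. -/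
def WallTwoPointLaw : Prop :=
  ∃ C : ℝ, 0 < C ∧ ∀ t : ℝ, 0 < t →
    Tendsto (fun n : ℕ ↦ (n : ℝ) ^ (2 / 3 : ℝ) *
        Phalf (openConnIn (strip n) ![0, 0] ![⌊t * n⌋, 0]))
      atTop
      (nhds (C * Real.exp (-(Real.pi * t / 3)) * (1 - Real.exp (-(Real.pi * t))) ^ (-(2 / 3) : ℝ)))

/-- The rate half of `WallTwoPointLaw` read at `t → ∞` is the `γ₁`-type statement of the
route's crux 3 for the point-to-point function: `lim_m −log P[(0,0) ↔ (m,0) in ℤ×[0,n]]/m =: γ(n)`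
exists and `n·γ(n) → π/3`. (Consistency link, not a new claim.) -/
def WallRate : Prop :=
  ∃ γ : ℕ → ℝ, (∀ n : ℕ, 1 ≤ n → Tendsto (fun m : ℕ ↦ -Real.log
      (Phalf (openConnIn (strip n) ![0, 0] ![(m : ℤ), 0])) / (m : ℝ)) atTop (nhds (γ n))) ∧
    Tendsto (fun n : ℕ ↦ (n : ℝ) * γ n) atTop (nhds (Real.pi / 3))

/-- Sanity: the wall law at small `t` is consistent with a half-plane two-point exponent `2/3`
(pure bookkeeping identity on the limit shape: `e^{-πt/3}(1-e^{-πt})^{-2/3} ~ (πt)^{-2/3}`). -/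
theorem wall_shape_small_t (t : ℝ) (ht : 0 < t) :
    0 < Real.exp (-(Real.pi * t / 3)) * (1 - Real.exp (-(Real.pi * t))) ^ (-(2 / 3) : ℝ) := by
  have h1 : Real.exp (-(Real.pi * t)) < 1 := by
    have h := Real.exp_lt_exp.2 (show -(Real.pi * t) < 0 by nlinarith [Real.pi_pos])
    simpa using h
  have h2 : 0 < 1 - Real.exp (-(Real.pi * t)) := by linarith
  positivity

end Summit.CriticalPhenomena.CardyFormulaZ2.Cruxes.BoundaryDefectGaussianR.IdeatorThree
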